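import Summits.AtomisticToContinuum.BoseEinsteinCondensation.Theorems.BECCutLineWeakDisorderAcrossCutDefs
import Summits.AtomisticToContinuum.BoseEinsteinCondensation.Theorems.BECCutLineWeakDisorderTwoReplicaTransienceBoundFactorisation
import Summits.AtomisticToContinuum.BoseEinsteinCondensation.Theorems.BECCutLineWeakDisorderTwoReplicaTransienceBoundDecoupling
import Summits.AtomisticToContinuum.BoseEinsteinCondensation.Theorems.BECCutLineWeakDisorderAcrossCutCrossCovarianceFinite
import Summits.AtomisticToContinuum.BoseEinsteinCondensation.Theorems.BECCutLineWeakDisorderAcrossCutMeanProfileFreeGas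
import HarnessLib

/-!
# Route `BECCutLineWeakDisorder`, crux `TwoReplicaTransienceBound` (stmt-AtomisticToContinuum-9687),
# line `across-cut-thinning` (v2, lead c6): BOOKKEEPING lemmas + stub `stub_acrossCutPointwise`

Support file (`--supports stmt-AtomisticToContinuum-9687`). Content: the planner's checked-skeleton
lemmas, moved verbatim (names and statements byte-identical, the exceptions flagged below) from the sections
"Bookkeeping lemmas for the composition (proved)" and `section Partition` of the checked skeleton
`Cruxes/TwoReplicaTransienceBound/Lines/across_cut_thinning.lean` (line card
`Cruxes/TwoReplicaTransienceBound/Lines/across-cut-thinning.md`), now stated over the landed vocabulary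
of `Theorems/BECCutLineWeakDisorderAcrossCutDefs.lean` (`partSlice`, `blockAmp`, `acrossPR`, `bathTwo`)
and the sibling block vocabulary (`blockMass`, `levelSq`, `uvParticipation`, `dyadicCube` of
`Theorems/BECCutLineWeakDisorderLandscapeBoundSibling{Defs,Telescope,Compose}.lean`); the lead's
sorry-free composition file `Theorems/BECCutLineWeakDisorderAcrossCutCompose.lean` compiles against
these names (with `le_one_add_pow r two_ne_zero` for `le_one_add_sq r`, `bathTwo_ne_top v L hT n` for
`bathTwo_ne_top hT n`, `partSlice_eq_zero_of_notMem` for `partSlice_eq_zero` and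
`measurable_fkPartition_bath` for `measurable_fkPartition'`, see the deviations). At the end the
registered bookkeeping stub
`stub_acrossCutPointwise : Goal.stub_acrossCutPointwise` — the pointwise factorisation
`L³ m ≤ s² · r̄_K · R_IR,K` of the slice participation into within-block × across-block participation
(`= vol_mul_le_sq_mul_uv_mul_across`).

What is here (all kernel-checked, elementary measure theory in `[0, ∞]`):
* finite Cauchy–Schwarz `(Σ a)² ≤ #s Σ a²`, `#blocks = 8^K`, `s² ≤ 8^K S_K`, slice Cauchy–Schwarz
  `s² ≤ L³ m`, `ℓ_K³ 8^K = L³`, the two pointwise participation inequalities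
  `s² r̄_K ≤ L³ m ≤ s² r̄_K R_IR,K`, scale-invariance of `R_IR,K`, `r ≤ 1 + r^k` (`k ≠ 0`; DEVIATION
  1 from verbatim: the skeleton's `le_one_add_sq` restates the landed `ENNReal.le_one_add_sq` of a
  Navier–Stokes Literature module and is replaced by `le_one_add_pow`, see its docstring);
* `section Partition`: `Z_{n+1}(x::Y) ≤ Z_n(Y)` (landed `stub_factorisation` + `tracer ≤ 1`), vanishing
  of the insertion slice off the box in the bath coordinates, measurability of `partSlice` / `blockAmp` /
  `levelSq` / `acrossPR` in the slice, `s_Φ(Y) ≤ L³`, finiteness of `∫ s_Φ²`, `Σ_Q A_Q ≤ s_Φ`.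
  DEVIATIONS 2–5 (landed meanwhile by sibling workers of this line in the same namespace, hence provided
  through the imports instead of re-declared): `bathTwo_ne_top (v) (L) (hT) (n)` (finiteness of `∫ Z_n²`;
  the skeleton's had `v, L` implicit) of `Theorems/BECCutLineWeakDisorderAcrossCutCrossCovarianceFinite.lean`;
  `measurable_partSlice_uncurry` (identical), `partSlice_eq_zero_of_notMem` (= the skeleton's
  `partSlice_eq_zero`) and `measurable_fkPartition_bath` (= the skeleton's `measurable_fkPartition'`) of
  `Theorems/BECCutLineWeakDisorderAcrossCutMeanProfileFreeGas.lean`.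

NOT here: any of the seven analytic stubs of the line or the composition (neighbours' files).
-/

noncomputable section

namespace Summit.AtomisticToContinuum.BoseEinsteinCondensation.Cruxes.TwoReplicaTransienceBound.AcrossCutThinning

open MeasureTheory Filter Set Finset
open scoped ENNReal NNReal Topology BigOperators
open Literature.MathematicalPhysics.QuantumManyBody.BoseGas
open Summit.AtomisticToContinuum.BoseEinsteinCondensation.Theses.BECCutLineWeakDisorder
open Summit.AtomisticToContinuum.BoseEinsteinCondensation.Cruxes.TwoReplicaTransienceBound.TracerDecoupling
open Summit.AtomisticToContinuum.BoseEinsteinCondensation.Cruxes.LandscapeBound.SiblingTelescopingChaining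

variable {n : ℕ}

/-! ## Bookkeeping lemmas for the composition (proved) -/

/-- Cauchy–Schwarz for a finite `ℝ≥0∞`-sum: `(Σ_e a_e)² ≤ #s · Σ_e a_e²`
(copied from `IdeatorSketch5.sq_sum_le_card_mul_sum_sq_ennreal`). -/
theorem sq_sum_le_card_mul_sum_sq {ι : Type*} (s : Finset ι) (a : ι → ℝ≥0∞) :
    (∑ e ∈ s, a e) ^ 2 ≤ (s.card : ℝ≥0∞) * ∑ e ∈ s, a e ^ 2 := by
  have h := ENNReal.rpow_sum_le_const_mul_sum_rpow s a (p := 2) (by norm_num)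
  norm_num at h
  simpa [ENNReal.rpow_two] using h

/-- The number of level-`K` blocks is `8^K`. -/
theorem card_blocks (K : ℕ) :
    ((Finset.univ : Finset (Fin 3 → Fin (2 ^ K))).card : ℝ≥0∞) = 8 ^ K := by
  rw [Finset.card_univ, Fintype.card_fun, Fintype.card_fin, Fintype.card_fin]
  push_cast
  rw [← pow_mul, mul_comm, pow_mul]
  norm_num

/-- `s² ≤ 8^K S_K` for a slice vanishing off the box (covering by blocks + Cauchy–Schwarz over blocks). -/
theorem sq_lintegral_le_levelSq {g : Space → ℝ≥0∞} {L : ℝ} (hL : 0 < L)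
    (h0 : ∀ x, x ∉ box L → g x = 0) (K : ℕ) :
    (∫⁻ x, g x) ^ 2 ≤ 8 ^ K * levelSq g L K := by
  calc (∫⁻ x, g x) ^ 2 ≤ (∑ i : Fin 3 → Fin (2 ^ K), blockMass g L K i) ^ 2 := by
        gcongr
        exact lintegral_le_sum_blockMass hL h0 K
    _ ≤ ((Finset.univ : Finset (Fin 3 → Fin (2 ^ K))).card : ℝ≥0∞) *
          ∑ i : Fin 3 → Fin (2 ^ K), blockMass g L K i ^ 2 := sq_sum_le_card_mul_sum_sq _ _
    _ = 8 ^ K * levelSq g L K := by rw [card_blocks]; rfl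

/-- **Slice Cauchy–Schwarz** `s² ≤ L³ m` for a slice vanishing off `Λ_L`
(adapted from `Negative.ConstantAtLeastOne.slice_le_ratio`). -/
theorem sq_lintegral_le_vol_mul {g : Space → ℝ≥0∞} (hg : Measurable g) {L : ℝ} (hL : 0 ≤ L)
    (h0 : ∀ x, x ∉ box L → g x = 0) :
    (∫⁻ x, g x) ^ 2 ≤ ENNReal.ofReal (L ^ 3) * ∫⁻ x, g x ^ 2 := by
  have hind : ∀ x, g x = (box L).indicator (fun _ => (1 : ℝ≥0∞)) x * g x := by
    intro x
    by_cases hx : x ∈ box L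
    · simp [Set.indicator_of_mem hx]
    · simp [Set.indicator_of_notMem hx, h0 x hx]
  have h1 := ENNReal.lintegral_mul_le_Lp_mul_Lq volume Real.HolderConjugate.two_two
    (f := (box L).indicator fun _ => (1 : ℝ≥0∞)) (g := g)
    ((measurable_const.indicator (measurableSet_box L)).aemeasurable) hg.aemeasurable
  have hI : ∫⁻ x, (box L).indicator (fun _ => (1 : ℝ≥0∞)) x ^ (2 : ℝ) = ENNReal.ofReal (L ^ 3) := by
    have : ∀ x, (box L).indicator (fun _ => (1 : ℝ≥0∞)) x ^ (2 : ℝ) =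
        (box L).indicator (fun _ => (1 : ℝ≥0∞)) x := fun x => by
      by_cases hx : x ∈ box L <;> simp [hx]
    simp_rw [this]
    rw [lintegral_indicator (measurableSet_box L), setLIntegral_const, one_mul, volume_box,
      ENNReal.ofReal_pow hL]
  calc (∫⁻ x, g x) ^ 2 = (∫⁻ x, (box L).indicator (fun _ => (1 : ℝ≥0∞)) x * g x) ^ 2 := by
        congr 1
        exact lintegral_congr fun x => hind x
    _ ≤ ((∫⁻ x, (box L).indicator (fun _ => (1 : ℝ≥0∞)) x ^ (2 : ℝ)) ^ (1 / (2 : ℝ)) *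
          (∫⁻ x, g x ^ (2 : ℝ)) ^ (1 / (2 : ℝ))) ^ 2 := by
        gcongr
        simpa only [Pi.mul_apply] using h1
    _ = ENNReal.ofReal (L ^ 3) * ∫⁻ x, g x ^ 2 := by
        rw [hI, sq_rpow_half_mul_rpow_half]
        simp_rw [ENNReal.rpow_two]

/-- `ℓ_K³ · 8^K = L³` in `[0, ∞]`. -/
theorem blockVol_mul_card {L : ℝ} (hL : 0 ≤ L) (K : ℕ) :
    ENNReal.ofReal ((L / 2 ^ K) ^ 3) * 8 ^ K = ENNReal.ofReal (L ^ 3) := by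
  rw [show (8 : ℝ≥0∞) ^ K = ENNReal.ofReal ((8 : ℝ) ^ K) by
      rw [ENNReal.ofReal_pow (by norm_num)]; norm_num,
    ← ENNReal.ofReal_mul (by positivity)]
  congr 1
  rw [div_pow, show ((2 : ℝ) ^ K) ^ 3 = 8 ^ K by rw [← pow_mul, mul_comm, pow_mul]; norm_num]
  field_simp

/-- **Pointwise: `s² · r̄_K ≤ L³ m`** (no side conditions: `ENNReal.mul_div_le`). -/
theorem sq_mul_uv_le {g : Space → ℝ≥0∞} {L : ℝ} (hL : 0 < L)
    (h0 : ∀ x, x ∉ box L → g x = 0) (K : ℕ) :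
    (∫⁻ x, g x) ^ 2 * uvParticipation g L K ≤ ENNReal.ofReal (L ^ 3) * ∫⁻ x, g x ^ 2 := by
  unfold uvParticipation
  calc (∫⁻ x, g x) ^ 2 * (ENNReal.ofReal ((L / 2 ^ K) ^ 3) * (∫⁻ x, g x ^ 2) / levelSq g L K)
      ≤ (8 ^ K * levelSq g L K) *
          (ENNReal.ofReal ((L / 2 ^ K) ^ 3) * (∫⁻ x, g x ^ 2) / levelSq g L K) :=
        mul_le_mul' (sq_lintegral_le_levelSq hL h0 K) le_rfl
    _ = 8 ^ K * (levelSq g L K *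
          (ENNReal.ofReal ((L / 2 ^ K) ^ 3) * (∫⁻ x, g x ^ 2) / levelSq g L K)) := by ring
    _ ≤ 8 ^ K * (ENNReal.ofReal ((L / 2 ^ K) ^ 3) * ∫⁻ x, g x ^ 2) :=
        mul_le_mul' le_rfl ENNReal.mul_div_le
    _ = ENNReal.ofReal (L ^ 3) * ∫⁻ x, g x ^ 2 := by
        rw [← mul_assoc, mul_comm (8 ^ K : ℝ≥0∞), blockVol_mul_card hL.le]

/-- **Pointwise: `L³ m ≤ s² · r̄_K · R_IR,K`** (equality off junk values) for a bounded slice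
vanishing off the box. -/
theorem vol_mul_le_sq_mul_uv_mul_across {g : Space → ℝ≥0∞} (hg : Measurable g) {L : ℝ} (hL : 0 < L)
    (h0 : ∀ x, x ∉ box L → g x = 0) (hs : ∫⁻ x, g x ≠ ⊤) (K : ℕ) :
    ENNReal.ofReal (L ^ 3) * ∫⁻ x, g x ^ 2 ≤
      (∫⁻ x, g x) ^ 2 * uvParticipation g L K * acrossPR g L K := by
  rcases eq_or_ne (∫⁻ x, g x) 0 with hs0 | hs0
  · -- `s = 0`: the slice vanishes a.e., so `m = 0`
    have hae : g =ᵐ[volume] 0 := (lintegral_eq_zero_iff hg).1 hs0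
    have hm0 : ∫⁻ x, g x ^ 2 = 0 := by
      rw [lintegral_eq_zero_iff (hg.pow_const 2)]
      filter_upwards [hae] with x hx
      simp [hx]
    rw [hm0, mul_zero]
    exact bot_le
  have hS0 : levelSq g L K ≠ 0 := levelSq_ne_zero hL h0 hs0 K
  have hSt : levelSq g L K ≠ ⊤ := levelSq_ne_top hs K
  have hs2 : (∫⁻ x, g x) ^ 2 ≠ 0 := pow_ne_zero 2 hs0
  have hs2t : (∫⁻ x, g x) ^ 2 ≠ ⊤ := ENNReal.pow_ne_top hs
  unfold uvParticipation acrossPR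
  set s := ∫⁻ x, g x
  set m := ∫⁻ x, g x ^ 2
  set S := levelSq g L K
  set ℓ3 := ENNReal.ofReal ((L / 2 ^ K) ^ 3)
  refine le_of_eq ?_
  calc ENNReal.ofReal (L ^ 3) * m = ℓ3 * 8 ^ K * m := by rw [blockVol_mul_card hL.le]
    _ = 8 ^ K * (ℓ3 * m) := by ring
    _ = 8 ^ K * (S * (ℓ3 * m / S)) := by rw [ENNReal.mul_div_cancel hS0 hSt]
    _ = (ℓ3 * m / S) * (8 ^ K * S) := by ring
    _ = (ℓ3 * m / S) * (s ^ 2 * (8 ^ K * S / s ^ 2)) := by rw [ENNReal.mul_div_cancel hs2 hs2t]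
    _ = s ^ 2 * (ℓ3 * m / S) * (8 ^ K * S / s ^ 2) := by ring

/-- `R_IR,K` is scale-free. -/
theorem acrossPR_const_mul {c : ℝ≥0∞} (hc0 : c ≠ 0) (hc : c ≠ ⊤) (g : Space → ℝ≥0∞) (L : ℝ) (K : ℕ) :
    acrossPR (fun x => c * g x) L K = acrossPR g L K := by
  unfold acrossPR
  have h1 : ∫⁻ x, c * g x = c * ∫⁻ x, g x := lintegral_const_mul' _ _ hc
  rw [h1, levelSq_const_mul hc, mul_pow, mul_left_comm,
    ENNReal.mul_div_mul_left _ _ (pow_ne_zero 2 hc0) (ENNReal.pow_ne_top hc)]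

/-- `r ≤ 1 + r^k` in `[0, ∞]` for every exponent `k ≠ 0` (by cases on `r ≤ 1`). The skeleton's
`le_one_add_sq` (`k = 2`) is NOT re-declared here: it restates the landed
`ENNReal.le_one_add_sq` of `Literature/Analysis/FluidPDE/CylinderPairings.lean` (gate `dedup.landed`),
whose module is not imported to keep the Navier–Stokes import cone out of this route; the composition
uses `le_one_add_pow r two_ne_zero` instead. -/
theorem le_one_add_pow (r : ℝ≥0∞) {k : ℕ} (hk : k ≠ 0) : r ≤ 1 + r ^ k := by
  rcases le_total r 1 with h | h
  · exact h.trans le_self_add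
  · exact (le_self_pow₀ h hk).trans le_add_self

section Partition

variable {v : ℝ → ℝ≥0∞} {L T : ℝ}

/-- Adding the tagged line only lowers the partition function: `Z_{n+1}(x::Y) ≤ Z_n(Y)`
(`stub_factorisation` + `tracer ≤ 1`). -/
theorem partSlice_le_fkPartition (hv : Measurable v) (L T : ℝ) (Y : Config n) (x : Space) :
    partSlice v L T Y x ≤ fkPartition v L T Y := by
  unfold partSlice
  rw [stub_factorisation n v hv L T x Y]
  calc ∫⁻ ωb, fkWeight v L T Y ωb * tracer v L T x Y ωb ∂wienerPaths n
      ≤ ∫⁻ ωb, fkWeight v L T Y ωb * 1 ∂wienerPaths n :=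
        lintegral_mono fun ωb => mul_le_mul' le_rfl (tracer_le_one v L T x Y ωb)
    _ = fkPartition v L T Y := by simp [fkPartition, fkSemigroup]

-- The insertion slice vanishes off the box in the tagged coordinate (`T ≥ 0`): the skeleton's
-- `partSlice_eq_zero (hT) (Y) {x} (hx)` is NOT re-declared here — it restates (gate `dedup.landed`) the landed
-- `partSlice_eq_zero_of_notMem (hT) (Y) {x} (hx)` of `Theorems/BECCutLineWeakDisorderAcrossCutMeanProfileFreeGas.lean`
-- (imported above; same arguments, used below as is).

/-- The insertion slice vanishes when the bath slice is off the box (`T ≥ 0`). -/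
theorem partSlice_eq_zero_of_bath (hT : 0 ≤ T) {Y : Config n} (hY : Y ∉ boxN n L) (x : Space) :
    partSlice v L T Y x = 0 := by
  unfold partSlice fkPartition
  have hX : Matrix.vecCons x Y ∉ boxN (n + 1) L := by
    intro hmem
    exact hY fun i => by simpa using hmem i.succ
  exact fkSemigroup_of_notMem v hT _ hX

-- Joint measurability of `(Y, x) ↦ Z_{n+1}(x::Y)`: the skeleton's `measurable_partSlice_uncurry` is NOT
-- re-declared here — the identical statement under the identical fully-qualified name is the landed one of
-- `Theorems/BECCutLineWeakDisorderAcrossCutMeanProfileFreeGas.lean` (imported above; used below as is).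

/-- Measurability of the insertion slice `x ↦ Z_{n+1}(x::Y)` at a fixed bath slice `Y`. -/
theorem measurable_partSlice (hv : Measurable v) (L T : ℝ) (Y : Config n) :
    Measurable (partSlice v L T Y) := by
  unfold partSlice fkPartition
  exact (measurable_fkSemigroup hv L T measurable_const).comp
    (measurable_vecCons.comp (measurable_id.prodMk measurable_const))

/-- Measurability of the slice mass `Y ↦ s_Φ(Y) = ∫ Z_{n+1}(x::Y) dx` (Tonelli). -/
theorem measurable_lintegral_partSlice (hv : Measurable v) (L T : ℝ) :
    Measurable fun Y : Config n => ∫⁻ x, partSlice v L T Y x :=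
  (measurable_partSlice_uncurry hv L T).lintegral_prod_right'

/-- Measurability of the slice second moment `Y ↦ m_Φ(Y) = ∫ Z_{n+1}(x::Y)² dx` (Tonelli). -/
theorem measurable_lintegral_partSlice_sq (hv : Measurable v) (L T : ℝ) :
    Measurable fun Y : Config n => ∫⁻ x, partSlice v L T Y x ^ 2 :=
  ((measurable_partSlice_uncurry hv L T).pow_const 2).lintegral_prod_right'

/-- Measurability of the block insertion amplitude `Y ↦ A_Q(Y) = ∫_Q Z_{n+1}(x::Y) dx`
(Tonelli for the restricted measure `dx|_Q`). -/
theorem measurable_blockAmp (hv : Measurable v) (L T : ℝ) (j : ℕ) (i : Fin 3 → Fin (2 ^ j)) :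
    Measurable fun Y : Config n => blockAmp v L T j i Y := by
  unfold blockAmp blockMass
  exact (measurable_partSlice_uncurry hv L T).lintegral_prod_right'
    (ν := (volume : Measure Space).restrict (dyadicCube L j i))

/-- Measurability of the level-`j` block square sum `Y ↦ S_j(Y) = Σ_Q A_Q(Y)²` of the insertion
slice (finite sum of squares of measurable block amplitudes). -/
theorem measurable_levelSq_partSlice (hv : Measurable v) (L T : ℝ) (j : ℕ) :
    Measurable fun Y : Config n => levelSq (partSlice v L T Y) L j := by
  unfold levelSq
  exact Finset.measurable_sum _ fun i _ => (measurable_blockAmp hv L T j i).pow_const 2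

/-- Measurability of the across-block participation `Y ↦ R_IR,K(Y) = 8^K S_K(Y)/s_Φ(Y)²` of the
insertion slice (products and quotients of measurable `[0, ∞]`-valued maps). -/
theorem measurable_acrossPR_partSlice (hv : Measurable v) (L T : ℝ) (K : ℕ) :
    Measurable fun Y : Config n => acrossPR (partSlice v L T Y) L K := by
  unfold acrossPR
  exact (measurable_const.mul (measurable_levelSq_partSlice hv L T K)).div
    ((measurable_lintegral_partSlice hv L T).pow_const 2)

-- Measurability of the bare bath partition function `Y ↦ Z_n(Y)`: the skeleton's
-- `measurable_fkPartition' (hv) (L T)` is NOT re-declared here — it restates (gate `dedup.landed`) the landed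
-- `measurable_fkPartition_bath (hv) (L T)` of `Theorems/BECCutLineWeakDisorderAcrossCutMeanProfileFreeGas.lean`
-- (imported above; same arguments).

/-- `s_Φ(Y) ≤ vol(Λ_L)` (`Z ≤ 1`, Dirichlet in the tagged coordinate). -/
theorem lintegral_partSlice_le (hT : 0 ≤ T) (Y : Config n) :
    ∫⁻ x, partSlice v L T Y x ≤ ENNReal.ofReal L ^ 3 := by
  have hle : ∀ x, partSlice v L T Y x ≤ (box L).indicator (fun _ => (1 : ℝ≥0∞)) x := by
    intro x
    by_cases hx : x ∈ box L
    · rw [Set.indicator_of_mem hx]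
      exact fkPartition_le_one v L T _
    · rw [Set.indicator_of_notMem hx, partSlice_eq_zero_of_notMem hT Y hx]
  calc ∫⁻ x, partSlice v L T Y x ≤ ∫⁻ x, (box L).indicator (fun _ => (1 : ℝ≥0∞)) x := lintegral_mono hle
    _ = volume (box L) := by rw [lintegral_indicator_const (measurableSet_box L), one_mul]
    _ = ENNReal.ofReal L ^ 3 := volume_box L

/-- `∫ s_Φ(Y)² dY < ∞`. -/
theorem lintegral_sq_lintegral_partSlice_ne_top (hv : Measurable v) (hT : 0 ≤ T) :
    ∫⁻ Y : Config n, (∫⁻ x, partSlice v L T Y x) ^ 2 ≠ ⊤ := by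
  have hle : ∀ Y : Config n, (∫⁻ x, partSlice v L T Y x) ^ 2 ≤
      (boxN n L).indicator (fun _ => (ENNReal.ofReal L ^ 3) ^ 2) Y := by
    intro Y
    by_cases hY : Y ∈ boxN n L
    · rw [Set.indicator_of_mem hY]
      exact pow_le_pow_left' (lintegral_partSlice_le hT Y) 2
    · rw [Set.indicator_of_notMem hY]
      have : ∫⁻ x, partSlice v L T Y x = 0 := by
        rw [lintegral_eq_zero_iff (measurable_partSlice hv L T Y)]
        exact Eventually.of_forall fun x => partSlice_eq_zero_of_bath hT hY x
      simp [this]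
  refine ne_top_of_le_ne_top ?_ (lintegral_mono hle)
  rw [lintegral_indicator_const (measurableSet_boxN n L)]
  exact ENNReal.mul_ne_top (ENNReal.pow_ne_top (ENNReal.pow_ne_top ENNReal.ofReal_ne_top))
    (volume_boxN_lt_top n L).ne

-- `∫ Z_n² dY < ∞`: the skeleton's `bathTwo_ne_top (hT : 0 ≤ T) (n : ℕ)` is NOT re-declared here —
-- the fully-qualified name is taken by the landed
-- `bathTwo_ne_top (v) (L) {T} (hT : 0 ≤ T) (n)` of `Theorems/BECCutLineWeakDisorderAcrossCutCrossCovarianceFinite.lean`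
-- (p137108, imported above; use `bathTwo_ne_top v L hT n`).

/-- `Σ_Q A_Q(Y) ≤ s_Φ(Y)` (the blocks are disjoint). -/
theorem sum_blockAmp_le (L T : ℝ) (j : ℕ) (Y : Config n) :
    ∑ i : Fin 3 → Fin (2 ^ j), blockAmp v L T j i Y ≤ ∫⁻ x, partSlice v L T Y x := by
  unfold blockAmp blockMass
  have hU := lintegral_iUnion (μ := (volume : Measure Space))
    (fun i => measurableSet_dyadicCube L j i) (fun i i' h => disjoint_dyadicCube L j h)
    (partSlice v L T Y)
  rw [tsum_fintype] at hU
  rw [← hU]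
  exact setLIntegral_le_lintegral _ _

end Partition

/-! ## The registered bookkeeping stub `stub_acrossCutPointwise` -/

namespace Goal

/-- Registered bookkeeping stub `stub_acrossCutPointwise` (= the statement of
`vol_mul_le_sq_mul_uv_mul_across`): for a measurable slice `g` vanishing off `Λ_L` (`L > 0`) with
`∫ g < ∞`, at every depth `K`, `L³ ∫ g² ≤ (∫ g)² · r̄_K(g) · R_IR,K(g)` — the slice participation
`L³ m/s²` factors (with `≤`, equality off junk values) into within-block × across-block participation. -/
abbrev stub_acrossCutPointwise : Prop :=
  ∀ {g : Space → ℝ≥0∞}, Measurable g → ∀ {L : ℝ}, 0 < L → (∀ x, x ∉ box L → g x = 0) →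
    (∫⁻ x, g x) ≠ ⊤ → ∀ K : ℕ,
      ENNReal.ofReal (L ^ 3) * ∫⁻ x, g x ^ 2 ≤ (∫⁻ x, g x) ^ 2 * uvParticipation g L K * acrossPR g L K

end Goal

/-- PROVED bookkeeping stub `stub_acrossCutPointwise`: `L³ m ≤ s² · r̄_K · R_IR,K`
(`vol_mul_le_sq_mul_uv_mul_across`). -/
theorem stub_acrossCutPointwise : Goal.stub_acrossCutPointwise :=
  fun hg _ hL h0 hs K => vol_mul_le_sq_mul_uv_mul_across hg hL h0 hs K

end Summit.AtomisticToContinuum.BoseEinsteinCondensation.Cruxes.TwoReplicaTransienceBound.AcrossCutThinning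

end
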